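import Summits.BirchSwinnertonDyer.BirchSwinnertonDyer.Theorems.PrintCf2RubinValueTwoEllipticUnitsTwoVariableMeasureFourDivisible
import Literature.NumberTheory.EllipticCurves.ProfiniteGroupDistributionTranslateScale
import Literature.NumberTheory.EllipticCurves.DeShalit1987.KatzPAdicLValue
import HarnessLib

set_option linter.dupNamespace false
set_option autoImplicit false

/-!
# The TRANSLATED TWELFTH of the two-variable measure: `μ″ := δ_{τ,0}(Θε·μ/12)`, `‖μ″‖ ≤ 1`, `12·∫ ê dμ″ = Θε·∫ ê d(δ_{τ,0}μ)`

Cell `bsd-print-cf2`, width seat `bsd-line-cf2-p1-w3` g31 (the (e)-assembly packager, PART 2 of `hseam♯_of_lane`); print leaf 24720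
`KatzDistributionsAtTwoPrint`, seam `hseam♯` (`…KatzMeasureJZeroSupplyOfChainSeamRoot`).  `--supports stmt-BirchSwinnertonDyer-24720`
(helper, Theses-free).  THEOREMS ONLY (no `def`, no named fact, no `sorry`); CONDITIONAL on the de Shalit II.2 prints (hypotheses, as in
TW(b)); nothing is closed; no summit statement is proved by this seat; BSD is not proved by any of this.

WHAT.  `hseam♯` asks, for the measure of record `μ` on the diagonal tower (D2's twisting relations), for SOME `μ′` on the same tower with
`μ′.bound ≤ 1` whose integrals of the avatars `ê` satisfy the twisted class-sum identity `hsum`.  PART 1 of the last packager file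
(`…KatzMeasureJZeroSeamClassSumAtLevel`, -w8 g13) proves that identity for any `I′` with `12·I′ = Θε·∫ ê d(δ_{τ,0} μ)`, `τ ∈ Γ_K` the
reading conjugacy of `…KatzMeasureJZeroReadingConjugacy` (Q-θ) and `Θε = Θ(ε_ϑ)` the root number unit (`‖Θε‖ ≤ 1`).  THIS file produces
the measure: from TW(b) (`exists_bound_le_one_twelfth_of_twoVariable_steps`: `μ₁`, `‖μ₁‖ ≤ 1`, `12·∫ f dμ₁ = Θε·∫ f dμ`) and T-1
(`ProfiniteGroupDistributionTranslateScale`: `δ_{τ,0}` keeps the bound, multiplies the integral of a MULTIPLICATIVE test function by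
`f τ`), with `ê(τσ) = ê(τ)ê(σ)` (`avatarValueAt_mul`):

* ★ `exists_translate_twelfth_of_twoVariable_steps (Θε) (hΘε : ‖Θε‖ ≤ 1) (τ)` : `∃ μ″, μ″.bound ≤ 1 ∧ ∀ eH, ê tower-continuous →
  12·∫ ê dμ″ = Θε·∫ ê d(δ_{τ,0} μ)` (and the unfolded form `= Θε·ê(τ)·∫ ê dμ`).

References: [deShalit1987] II.4.12 (p. 66–69: `μ(𝔣) = μ_𝔞/12δ_𝔞` is integral), II.4.14 (36)–(40) (p. 71–73), I.3.1 (p. 15–16).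
-/

noncomputable section

open scoped Classical nonZeroDivisors NumberField
open Field IsDedekindDomain IsDedekindDomain.HeightOneSpectrum ValuativeRel IsLocalRing MvPowerSeries
open Literature.NumberTheory.NumberFields
open Literature.NumberTheory.GaloisRepresentations Literature.NumberTheory.GaloisRepresentations.IsNonarchimedeanLocalField
  Literature.NumberTheory.GaloisRepresentations.LubinTate Literature.NumberTheory.GaloisRepresentations.ArtinLocalGlobal
  Literature.NumberTheory.PAdicHodge Literature.NumberTheory.LFunctions
open Literature.NumberTheory.EllipticCurves Literature.NumberTheory.EllipticCurves.GroupDistribution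
open Literature.NumberTheory.ComplexMultiplication.EllipticUnits
open Literature.NumberTheory.LFunctions.AbelianDensity (artinSymbol)
open Summit.BirchSwinnertonDyer.BirchSwinnertonDyer.Theorems.PrintCf2.EllipticUnitsLocal
open Summit.BirchSwinnertonDyer.BirchSwinnertonDyer.Theorems.PrintCf2.EllipticUnitsGlobal

namespace Summit.BirchSwinnertonDyer.BirchSwinnertonDyer.Theorems.PrintCf2.KatzMeasureJZeroTop

open Summit.BirchSwinnertonDyer.BirchSwinnertonDyer.Theorems.PrintCf2.EllipticUnitsTwoVariable
open Literature.NumberTheory.EllipticCurves.DeShalit1987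

variable {K : Type} [Field K] [NumberField K] {v vbar : HeightOneSpectrum (𝓞 K)}

section Diagonal

attribute [local instance] ltNormUniformSpace ltNormIsUniformAddGroup rk1 nF nE fintypeResidueField
attribute [local instance] RelNormCoherentUnits.instCommMonoid GlobalNormCoherentUnits.instCommMonoid GlobalNormCoherentUnits.galAction

variable [NumberField.IsTotallyComplex K]
  (h24ii : DeShalit1987.prop24_ii_galoisAction) (h24iii : DeShalit1987.prop24_iii_unit) (h25 : DeShalit1987.prop25_i_normRelation)
  (h27 : DeShalit1987.prop27_power)
  (hK : IsImaginaryQuadratic K) (ι : K →+* ℂ)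
  -- the chain of moduli
  (𝔣 : ℕ → Ideal (𝓞 K)) (𝔩 : ℕ → HeightOneSpectrum (𝓞 K)) (h𝔣succ : ∀ k, 𝔣 (k + 1) = 𝔣 k * (𝔩 k).asIdeal)
  (hdiv : ∀ k, (𝔩 k).asIdeal ∣ 𝔣 k)
  (𝔪c : ℕ → Ideal (𝓞 K)) (b : ℕ → ℕ) (h𝔣eq : ∀ k, 𝔣 k = 𝔪c k * vbar.asIdeal ^ (b k + 1))
  (h𝔪v : ∀ k, ¬ 𝔪c k ≤ v.asIdeal) (h𝔪vbar : ∀ k, ¬ 𝔪c k ≤ vbar.asIdeal)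
  (hw2 : ∀ u : (𝓞 K)ˣ, (u : 𝓞 K) - 1 ∈ vbar.asIdeal ^ 2 → u = 1)
  (hv2 : ((2 : ℕ) : 𝓞 K) ∈ v.asIdeal) (hvbar2 : ((2 : ℕ) : 𝓞 K) ∈ vbar.asIdeal) (hne : vbar ≠ v)
  -- the local model at `v`
  (hq : residueFieldCard (v.adicCompletion K) = 2)
  (h2 : (valuation (v.adicCompletion K)).IsUniformizer ((((2 : ℕ) : 𝒪[v.adicCompletion K]) : v.adicCompletion K)))
  (u : 𝒪[v.adicCompletion K]ˣ)
  {σ₀ : absoluteGaloisGroup (v.adicCompletion K)} (hσ₀ : IsAbsArithFrob σ₀)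
  {ε : (maxUnramifiedCompletion (v.adicCompletion K))ˣ}
  (hε : maxUnramifiedCompletion.galAut (v.adicCompletion K) σ₀ (ε : maxUnramifiedCompletion (v.adicCompletion K)) =
    algebraMap 𝒪[v.adicCompletion K] (maxUnramifiedCompletion (v.adicCompletion K)) (u : 𝒪[v.adicCompletion K]) *
      (ε : maxUnramifiedCompletion (v.adicCompletion K)))
  (θ : CompletedAlgClosure (v.adicCompletion K) →+* ℂ_[2])
  (hθ1 : ∀ z : CBall (v.adicCompletion K), ‖θ (z : CompletedAlgClosure (v.adicCompletion K))‖ ≤ 1)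
  (e₂ : v.adicCompletionIntegers K ≃+* ℤ_[2])
  (hΘe : ∀ a : 𝒪[v.adicCompletion K], (θ.comp ((CBall (v.adicCompletion K)).subtype.comp
      (algebraMap (UnrCoeff (v.adicCompletion K)) (CBall (v.adicCompletion K))))) (intToUnrCoeff (v.adicCompletion K) a) =
    padicIntCast ℂ_[2] (((e₂ : v.adicCompletionIntegers K →+* ℤ_[2]).comp (integerEquivAdicCompletionIntegers v).toRingHom) a))
  -- the per-modulus data (the `∃`-outputs of D2, as `∀`-binders, VERBATIM)
  (h𝔣0 : ∀ m : ℕ, 𝔣 m ≠ ⊥) (h𝔣1 : ∀ m : ℕ, 𝔣 m ≠ ⊤) (hvm : ∀ m : ℕ, ¬ 𝔣 m ≤ v.asIdeal)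
  (hwm : ∀ (m : ℕ) (u : (𝓞 K)ˣ), (u : 𝓞 K) - 1 ∈ 𝔣 m → u = 1) (hle : ∀ m : ℕ, 𝔣 (m + 1) ≤ 𝔣 m)
  (α : ℕ → 𝓞 K) (hα0 : ∀ m, α m ≠ 0) (hα𝔣 : ∀ m, α m - 1 ∈ 𝔣 m)
  (hαw : ∀ (m : ℕ) (w : HeightOneSpectrum (𝓞 K)), w ≠ v → α m ∉ w.asIdeal)
  (f : ℕ → ℕ) (hαπ : ∀ m, ((α m : K) : v.adicCompletion K) =
    ((((u : 𝒪[v.adicCompletion K]) * ((2 : ℕ) : 𝒪[v.adicCompletion K]) : 𝒪[v.adicCompletion K]) : v.adicCompletion K)) ^ f m)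
  (E : ℕ → IntermediateField (v.adicCompletion K) (AlgebraicClosure (v.adicCompletion K)))
  (hfd : ∀ m, FiniteDimensional (v.adicCompletion K) (E m)) (hgal : ∀ m, IsGalois (v.adicCompletion K) (E m))
  (hE : ∀ m, E m ≤ maxUnramified (v.adicCompletion K))
  (hdegE : ∀ (m : ℕ) (w : WeilGroup (v.adicCompletion K)),
    WeilGroup.toAbsGalois (v.adicCompletion K) w ∈ (E m).fixingSubgroup → (f m : ℤ) ∣ WeilGroup.deg w)
  (j : ∀ m : ℕ, unitBall (E m) →+* UnrCoeff (v.adicCompletion K))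
  (hj : ∀ m, (j m).comp (algebraMap (LTCoeff (v.adicCompletion K)) (unitBall (E m))) =
    (intToUnrCoeff (v.adicCompletion K)).comp (LTCoeff.of (v.adicCompletion K)).symm.toRingHom)
  (hjC : ∀ m, (algebraMap (UnrCoeff (v.adicCompletion K)) (CBall (v.adicCompletion K))).comp (j m) = unitBallToCBall (E m))
  (ψ : ∀ m n : ℕ, ↥(absRestrictNormalHom (rayClassField K (𝔣 m))).ker ⧸
    (rayAdicTower (𝔪 := 𝔣 m) (h𝔣0 m) v).U n → ZMod (2 ^ (n + 1)))
  (hψ : ∀ (m n : ℕ) (g : ↥(absRestrictNormalHom (rayClassField K (𝔣 m))).ker),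
    g ∈ (rayAdicTower (𝔪 := 𝔣 m) (h𝔣0 m) v).U 0 →
    ψ m n ((rayAdicTower (𝔪 := 𝔣 m) (h𝔣0 m) v).proj n g) =
      PadicInt.toZModPow (n + 1) ((((Units.map (e₂ : v.adicCompletionIntegers K →+* ℤ_[2]).toMonoidHom).comp
        (rayAdicCharacter (h𝔣0 m) (hvm m) (hwm m)))⁻¹ g : ℤ_[2]ˣ) : ℤ_[2]))
  (g : {c : Ideal (𝓞 K) // c ≠ ⊥ ∧ IsCoprime c (𝔣 0 * v.asIdeal)} → absoluteGaloisGroup K)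
  (hg : ∀ (c : {c : Ideal (𝓞 K) // c ≠ ⊥ ∧ IsCoprime c (𝔣 0 * v.asIdeal)}) (m k : ℕ),
    absRestrictNormalHom (rayClassField K (𝔣 m * v.asIdeal ^ (k + 1))) (g c) =
      artinSymbol (galFrob K (rayClassField K (𝔣 m * v.asIdeal ^ (k + 1)))) c.1)
  (x : ∀ (_ : {c : Ideal (𝓞 K) // c ≠ ⊥ ∧ IsCoprime c (𝔣 0 * v.asIdeal)}) (m k : ℕ),
    rayClassField K (𝔣 m * v.asIdeal ^ (k + 1)))
  (hx : ∀ (c : {c : Ideal (𝓞 K) // c ≠ ⊥ ∧ IsCoprime c (𝔣 0 * v.asIdeal)}) (m k : ℕ),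
    IsThetaValueOne ι (𝔣 m * v.asIdeal ^ (k + 1)) c.1
      (algClosureEmb ι ((x c m k : rayClassField K (𝔣 m * v.asIdeal ^ (k + 1))) : AlgebraicClosure K)))
  (hN : ∀ m n, ((rayAdicTower (𝔪 := 𝔣 m) (h𝔣0 m) v).U n).Normal)
  (hNabs : ∀ m n, ((absRayAdicTower (𝔪' := 𝔣 m) (h𝔣0 m) v).U n).Normal)
  -- ANY measure on the diagonal tower with the twisting relations
  (μ : GroupDistribution (SubgroupTower.diagonal (fun m ↦ absRayAdicTower (𝔪' := 𝔣 m) (h𝔣0 m) v)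
    (fun m n ↦ absRayAdicTower_U_anti (h𝔣0 m) (h𝔣0 (m + 1)) v (hle m) n)) ℂ_[2])
  (hμ : ∀ (c : {c : Ideal (𝓞 K) // c ≠ ⊥ ∧ IsCoprime c (𝔣 0 * v.asIdeal)}) (n : ℕ)
    (b : absoluteGaloisGroup K ⧸ (absRayAdicTower (𝔪' := 𝔣 n) (h𝔣0 n) v).U n),
    (twisting (g c) (Ideal.absNorm c.1 : ℂ_[2]) μ).μ n b =
    (GroupDistribution.induceFrom (Γ := absoluteGaloisGroup K)
      (fun k ↦ rayAdicTower_U_eq_subgroupOf (𝔪 := 𝔣 n) (h𝔣0 n) v k)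
      (fun b : GlobalNormCoherentUnits (h𝔣0 n) v ↦
        localMeasureFamily (h𝔣0 n) (hvm n) (hwm n) hq h2 u (E n) (hE n) hσ₀ hε θ hθ1 (j n) (hjC n) e₂ (ψ n) (hψ n)
          (RelNormCoherentUnits.ofGlobalUnits (h𝔣0 n) (hvm n) (hwm n) (isUniformizer_unit_mul h2 u) (hα0 n) (hα𝔣 n) (hαw n)
            (hαπ n) (E n) (hE n) (hdegE n) b))
      zero_le_one (fun _ ↦ le_rfl)
      (ellipticUnitsGlobal h24iii h25 hK ι (h𝔣0 n) (h𝔣1 n) (hvm n) (hwm n) c.2.1 (isCoprime_chain 𝔣 𝔩 h𝔣succ hdiv c.2.2 n)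
        (x c n) (hx c n))).μ n b)

set_option maxHeartbeats 1600000 in
include h24ii h27 𝔪c b h𝔣eq h𝔪v h𝔪vbar hw2 hv2 hvbar2 hne hΘe hfd hgal hj hg hμ in
/-- ★ **The translated twelfth** `μ″ := δ_{τ,0}(Θε·μ/12)`: `μ″.bound ≤ 1` and, for every `1`-dimensional framed avatar `eH` whose value
function `ê` is tower-continuous, `12·∫ ê dμ″ = Θε·∫ ê d(δ_{τ,0}μ) (= Θε·ê(τ)·∫ ê dμ)` — the measure `μ′` of `hseam♯` and the hypothesis
`hI` of PART 1 (`I′ := ∫ ê dμ″`). [cite: deShalit1987, II.4.12 (p. 69), II.4.14 (36)–(40) (p. 71–73), I.3.1 (p. 15–16)] -/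
theorem exists_translate_twelfth_of_twoVariable_steps (Θε : ℂ_[2]) (hΘε : ‖Θε‖ ≤ 1) (τ : absoluteGaloisGroup K) :
    ∃ μ'' : GroupDistribution (SubgroupTower.diagonal (fun m ↦ absRayAdicTower (𝔪' := 𝔣 m) (h𝔣0 m) v)
        (fun m n ↦ absRayAdicTower_U_anti (h𝔣0 m) (h𝔣0 (m + 1)) v (hle m) n)) ℂ_[2],
      μ''.bound ≤ 1 ∧
      ∀ eH : FramedGaloisRep K (PadicAlgCl 2) 1,
        (SubgroupTower.diagonal (fun m ↦ absRayAdicTower (𝔪' := 𝔣 m) (h𝔣0 m) v)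
          (fun m n ↦ absRayAdicTower_U_anti (h𝔣0 m) (h𝔣0 (m + 1)) v (hle m) n)).IsTowerContinuous (fun σ ↦ avatarValueAt eH σ) →
        (12 : ℂ_[2]) * μ''.integral (fun σ ↦ avatarValueAt eH σ) =
            Θε * (twisting τ 0 μ).integral (fun σ ↦ avatarValueAt eH σ) ∧
          (12 : ℂ_[2]) * μ''.integral (fun σ ↦ avatarValueAt eH σ) =
            Θε * avatarValueAt eH τ * μ.integral (fun σ ↦ avatarValueAt eH σ) := by
  obtain ⟨μ₁, hb₁, -, hint⟩ := exists_bound_le_one_twelfth_of_twoVariable_steps h24ii h24iii h25 h27 hK ι 𝔣 𝔩 h𝔣succ hdiv 𝔪c b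
    h𝔣eq h𝔪v h𝔪vbar hw2 hv2 hvbar2 hne hq h2 u hσ₀ hε θ hθ1 e₂ hΘe h𝔣0 h𝔣1 hvm hwm hle α hα0 hα𝔣 hαw f hαπ E hfd hgal hE hdegE j hj hjC
    ψ hψ g hg x hx hN hNabs μ hμ Θε hΘε
  refine ⟨twisting τ 0 μ₁, by rw [twisting_zero_bound']; exact hb₁, fun eH hcont ↦ ?_⟩
  have hmul : ∀ x, avatarValueAt eH (τ * x) = avatarValueAt eH τ * avatarValueAt eH x := fun x ↦ avatarValueAt_mul eH τ x
  have h1 : (12 : ℂ_[2]) * (twisting τ 0 μ₁).integral (fun σ ↦ avatarValueAt eH σ) =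
      Θε * avatarValueAt eH τ * μ.integral (fun σ ↦ avatarValueAt eH σ) := by
    rw [integral_twisting_zero_of_map_mul' τ μ₁ hcont hmul, mul_left_comm, hint _ hcont]
    ring
  refine ⟨?_, h1⟩
  rw [h1, integral_twisting_zero_of_map_mul' τ μ hcont hmul, mul_assoc]

end Diagonal

end Summit.BirchSwinnertonDyer.BirchSwinnertonDyer.Theorems.PrintCf2.KatzMeasureJZeroTop

end
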